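import Summits.HodgeConjecture.HodgeCM.Model.AdelicThetaModuleFin_1

/-! PORT of `HodgeCM/Model/AdelicThetaModuleFin.lean` (HodgeCMPerL run 82) — part 2: continuation of `Summits.HodgeConjecture.HodgeCM.Model.AdelicThetaModuleFin_1` (split at a top-level declaration boundary by port_pkg.py; scope re-opened below; declarations unchanged). -/

-- port_pkg: scope re-opened for this part (file-level context, then the namespace/section stack open at the cut)
set_option autoImplicit false
noncomputable section
open MeasureTheory NumberField NumberField.mixedEmbedding IsDedekindDomain
open Literature.NumberTheory.Automorphic Literature.NumberTheory.Weil1964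
open Literature.NumberTheory.Automorphic.WeightForms (restrictHom thetaClasses IsLevelCorrected IsWeightMatched)
open Literature.Geometry.ComplexHyperbolic.BallModel (U21)
open Literature.AlgebraicGeometry.HodgeTheory Literature.NumberTheory.Automorphic.PicardCM
open HodgeCM.PerL34.Seesaw HodgeCM.PerL34.RationalCoset HodgeCM.PerL34.SupplyAdelic
open HodgeCM.Model.SupplyInstance HodgeCM.Model.SupplyResidual
namespace HodgeCM
namespace Model
section Pin
open ThetaSpace MulAction
open Literature.Geometry.ComplexHyperbolic.BallModel (x₀)
open Literature.AlgebraicGeometry.ShimuraVarieties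
variable (hHD : exists_isReal_hodgeModel) (hI : hodgePQ_independent_of_hodgeModel)
  (h₁ : BallQuotientUniformised) (h₃ : CMAbelianVarietyRealised)
variable (S : ∀ {L : CMField} {ι₁ : L →+* ℂ} (V : HermSpace3 L ι₁) (c : SeesawCtx L), ThetaAdelicSide V c)
variable {L : CMField} {ι₁ : L →+* ℂ}
/-- **(J4) half of the junction's `hIso`, at the pin.**  In the regime `h`, a theta class `ω ∈ Θ_k(Γ)` of the END STATE
theta model (`thetaOf … (thetaSpaceInputOf … S) V c k Γ`) is a `(1,0)`-class `cl` of (C2)'s class-map datum `classMapDatumOf … Γ h`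
whose harmonic pull-back is holomorphic and is — as a function on `U(2,1)` — the archimedean restriction `F ∘ S.ιinf` of an
element `F` of the adèlic theta module of the slot's pair datum `(S V c).P k` (archimedean data `Stab(x₀) ≤ U(2,1)`, weight
`weightOf x₀`) which is SATURATED at `satLevelRegimeOf V h Γ.K`; in particular `F` is FIXED by every `k_f ∈ Γ.K` under the
`U(V)(𝔸_f)`-representation `adelicThetaRepFin`. -/
theorem exists_fixed_adelic_lift_of_mem_thetaOf (V : HermSpace3 L ι₁) (c : SeesawCtx L) (k : Fin 4) (Γ : Level V)
    (h : IsAnisotropic L V.Hm) {ω : (picardCMUniverse hHD hI h₁ h₃).CohC ((picardCMUniverse hHD hI h₁ h₃).pms L ι₁ V Γ) 1}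
    (hω : ω ∈ thetaOf _ (thetaClassInputOf _ (fun V c => thetaSpaceInputOf hHD hI h₁ h₃ S V c)) V c k Γ) :
    ∃ cl : (classMapDatumOf hHD hI h₁ h₃ Γ h (frameOf hHD hI h₁ h₃ Γ h) (MonoidHom.id U21)
        (isLevelCorrected_id (levelImage hHD hI h₁ h₃ Γ h) (stabilizer U21 x₀).subtype
          (BallForms.isPullbackCocycle_cotangentCocycle.weightOf x₀))
        (isWeightMatched_id (stabilizer U21 x₀).subtype (BallForms.isPullbackCocycle_cotangentCocycle.weightOf x₀))).H10,
      (cl : _) = ω ∧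
      (classMapDatumOf hHD hI h₁ h₃ Γ h (frameOf hHD hI h₁ h₃ Γ h) (MonoidHom.id U21)
        (isLevelCorrected_id (levelImage hHD hI h₁ h₃ Γ h) (stabilizer U21 x₀).subtype
          (BallForms.isPullbackCocycle_cotangentCocycle.weightOf x₀))
        (isWeightMatched_id (stabilizer U21 x₀).subtype (BallForms.isPullbackCocycle_cotangentCocycle.weightOf x₀))).pull cl ∈
        (classMapDatumOf hHD hI h₁ h₃ Γ h (frameOf hHD hI h₁ h₃ Γ h) (MonoidHom.id U21)
        (isLevelCorrected_id (levelImage hHD hI h₁ h₃ Γ h) (stabilizer U21 x₀).subtype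
          (BallForms.isPullbackCocycle_cotangentCocycle.weightOf x₀))
        (isWeightMatched_id (stabilizer U21 x₀).subtype (BallForms.isPullbackCocycle_cotangentCocycle.weightOf x₀))).Hol ∧
      ∃ F : adelicThetaSpan ((S V c).P k) (S V c).ιinf (stabilizer U21 x₀).subtype
          (BallForms.isPullbackCocycle_cotangentCocycle.weightOf x₀) ((S V c).P k).weightFunctions,
        F.1 ∈ adelicThetaSpanSat ((S V c).P k) (S V c).ιinf (stabilizer U21 x₀).subtype
          (BallForms.isPullbackCocycle_cotangentCocycle.weightOf x₀) (satLevelRegimeOf V h Γ.K) ((S V c).P k).weightFunctions ∧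
        (((classMapDatumOf hHD hI h₁ h₃ Γ h (frameOf hHD hI h₁ h₃ Γ h) (MonoidHom.id U21)
          (isLevelCorrected_id (levelImage hHD hI h₁ h₃ Γ h) (stabilizer U21 x₀).subtype
            (BallForms.isPullbackCocycle_cotangentCocycle.weightOf x₀))
          (isWeightMatched_id (stabilizer U21 x₀).subtype (BallForms.isPullbackCocycle_cotangentCocycle.weightOf x₀))).pull cl :
            weightForms _ _ _) : U21 → Fin 2 → ℂ) = F.1 ∘ ⇑(S V c).ιinf ∧
        ∀ kf ∈ Γ.K, (S V c).adelicThetaRepFin h k (stabilizer U21 x₀).subtype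
          (BallForms.isPullbackCocycle_cotangentCocycle.weightOf x₀) ((S V c).P k).weightFunctions kf F = F := by
  rw [thetaOf_thetaSpaceInputOf_of_isAnisotropic hHD hI h₁ h₃ S V c k Γ h] at hω
  obtain ⟨cl, hcl, hhol, F, hF, hpull⟩ := exists_sat_lift_of_mem_thetaClasses _ hω
  have hF' : F ∈ adelicThetaSpanSat ((S V c).P k) (S V c).ιinf (stabilizer U21 x₀).subtype
      (BallForms.isPullbackCocycle_cotangentCocycle.weightOf x₀) (satLevelRegimeOf V h Γ.K) ((S V c).P k).weightFunctions :=
    hF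
  exact ⟨cl, hcl, hhol, ⟨F, adelicThetaSpanSat_le_adelicThetaSpan hF'⟩, hF', hpull,
    fun kf hk => (S V c).adelicThetaRepFin_apply_eq_self_of_mem h k hF' hk⟩

end Pin

end Model
end HodgeCM

end
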